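import Literature.Analysis.FluidPDE.FluidComputer.ThresholdLevelTableW
import HarnessLib

/-!
# Kernel run of the level-table checker over the gate-data box, chunks 16 … 19 (bp3 gen 13, layer 4: robustness variant)

HONEST FRAMING: low prior, high value-of-information experiment on Tao's machine paradigm; NOT a
claim that NS blows up.

Four kernel evaluations (`decide +kernel`; no `native_decide`, no extra axioms) of `runSteps`
with the interval gate data `GIw` (all couplings within relative `10⁻³`, `δ ∈ [0, 1.001 δ₀]`),
25 steps each, from `Bw16` to `Bw20`.
-/

namespace Literature.Analysis.FluidPDE.FluidComputer

namespace ThresholdLevelTable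

set_option maxHeartbeats 10000000 in
set_option maxRecDepth 200000 in
/-- Chunk 16 of the data-box table run (steps 400 … 424). [folklore] -/
theorem runW16 : runSteps 60 12 3 GIw RbIt Bw16 chunk16 9080207597954848 = some Bw17 := by
  decide +kernel

set_option maxHeartbeats 10000000 in
set_option maxRecDepth 200000 in
/-- Chunk 17 of the data-box table run (steps 425 … 449). [folklore] -/
theorem runW17 : runSteps 60 12 3 GIw RbIt Bw17 chunk17 10806933931377166 = some Bw18 := by
  decide +kernel

set_option maxHeartbeats 10000000 in
set_option maxRecDepth 200000 in
/-- Chunk 18 of the data-box table run (steps 450 … 474). [folklore] -/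
theorem runW18 : runSteps 60 12 3 GIw RbIt Bw18 chunk18 12862021020692962 = some Bw19 := by
  decide +kernel

set_option maxHeartbeats 10000000 in
set_option maxRecDepth 200000 in
/-- Chunk 19 of the data-box table run (steps 475 … 499). [folklore] -/
theorem runW19 : runSteps 60 12 3 GIw RbIt Bw19 chunk19 15307911178806116 = some Bw20 := by
  decide +kernel

end ThresholdLevelTable

end Literature.Analysis.FluidPDE.FluidComputer
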